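import Summits.BirchSwinnertonDyer.BirchSwinnertonDyer.Theses.RamifiedHeegnerPair
import Summits.BirchSwinnertonDyer.BirchSwinnertonDyer.Theorems.RamifiedHeegnerPairGss2LowerAtThreeRankZeroJointLowerCertificate
import Summits.BirchSwinnertonDyer.BirchSwinnertonDyer.Theorems.RamifiedHeegnerPairLeafRankOneUpperAtThreeLeafTwistStable
import Literature.NumberTheory.EllipticCurves.HeegnerPointsOfConductorOneGaloisConjProofs
import Literature.NumberTheory.EllipticCurves.HeegnerPointsOfConductorOneRationalityProofs
import HarnessLib

/-!
# Route `RamifiedHeegnerPair`, residual member L₀ `Gss2LowerAtThreeRankZero` (stmt-BirchSwinnertonDyer-26023) — BY NAME: the rank-zero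
# LOWER half on the whole Gss2 leaf ⟸ five named facts ∧ A₀ (ONE McCallum certificate per rank-0 row at a split frame whose twist has
# analytic rank one) ∧ U₁ `LeafRankOneUpperAtThree` (26022) ∧ the rationality `L(W,1)/Ω_W ∈ ℚ` on the rank-0 rows

HONEST FRAMING. Theorems only; helper file (`--supports stmt-BirchSwinnertonDyer-26023`); nothing is booked, no item is closed, BSD is not
proved for any curve. Lead prover bsd-line-rhp-p1 g6, 2026-08-28. The class-level reading of the L₀ DOOR of
`…Gss2LowerAtThreeRankZeroJointLowerCertificate.lean` §2 (`missingLowerBoundAt_three_rankZero_of_structIrrCertificate_of_upperTwist`).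

WHAT IT SAYS. L₀ = item 26023 is the route's DECLARED RESIDUAL member («Kato's main conjecture ⊇ at an additive 3 made index-exact:
announced on the Fouquet–Wan locus only; no seat of this route attacks it»). This file gives it a road in the SAME currency as the L₁ line
(McCallum certificates = T1⁻ at an additive `3`, per-pair certifiable): for every non-CM rank-`0` leaf curve `W` SOME odd split Heegner frame
for `N_W` whose twist `W^{(d_K)}` has analytic rank ONE (Bump–Friedberg–Hoffstein supplies such `K`), with SOME derived-point certificate
of adjusted BSD depth — the statement A₀ (`hC0`, the text of A 27200 / A₃ₙₙ with the ranks of the pair exchanged) —, TOGETHER WITH the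
route's rank-one UPPER member U₁ 26022 at the twist (a leaf curve again: `RamifiedPairUpperBound.leaf_twist_of_heegner`) and the
rationality of `L(W,1)/Ω_W` on the rank-`0` rows (`hrat`; Manin–Drinfeld in print; in the tree it is also a by-product of U₀ 26024 or, on
the 3-adic-tower rows, of Kato 2004 Thm. 14.5 (3)), gives `Typed.MissingLowerBoundAt W 3`. Displayed named facts: Gross–Zagier ∀,
Kolyvagin ∀, GZK, modularity as analytic continuation, and the Matar–Nekovář structure fact (irreducible image; `E[3]` irreducible is
automatic on Gss2); Shimura reciprocity at conductor `1` and Darmon 2004 Thm. 3.6 are the tree's PROVED `_holds` theorems.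

COUPLING (read before booking anything): rhp-p2's U₁ road (p622097 / glue 27494) is «PUB⁺ → S2 → Σ★″ → L₀ → U₁», this file is «PUB → STRUCT
→ A₀ → U₁ → L₀». Both are theorems; together they say that MODULO the pair statements (T1⁺ divisibilities on the rank-one frames, T1⁻
certificates on the rank-zero frames) the two members U₁ and L₀ are ONE separation statement S₋, for which NO ℚ-method is in print at an
additive `3` (Kato-⊇ index-exact = Fouquet–Wan, announced; a rank-one Kato upper bound: nothing). A planner must not cite both roads to
declare both members reduced. The mirror pair S₊ = {L₁ 26021, U₀ 26024} is print on the tower rows (Kato A161″ gives U₀ there) and residual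
on the `3Nn` rows (skeleton v5 of 26021, stub `stub_leafRankZeroUpper_nonsplitRows`). Memo COUPLING-CALCULUS-rhp-p1-g6.md (crux dir of 26021).

References: [cite: MatarNekovar2019, Thm. 0.7 (p. 456) and §0.11 (p. 457)] [cite: McCallumLMS1991, §5 Lemma 5.1 (p. 303), Cor. 5.6 (p. 310)]
[cite: CastellaGrossiLeeSkinner2022, proof of Thm. 5.3.1, display (5.6)] [cite: BumpFriedbergHoffstein1990, Theorem (Introduction, pp. 543–544)]
[cite: Miller2011LMS, Def. 1.1] [cite: GrossZagier1986, Thm. I.(6.3), V.§2] [cite: Kolyvagin1990, Thm. A].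
-/

-- D-0017: single-problem summit, so `Summit.BirchSwinnertonDyer.BirchSwinnertonDyer.…` repeats a namespace BY DESIGN.
set_option linter.dupNamespace false
set_option autoImplicit false

noncomputable section

open scoped Classical NumberField

open WeierstrassCurve NumberField IsDedekindDomain
  Literature.NumberTheory.EllipticCurves Literature.NumberTheory.EllipticCurves.ModularForms
  Literature.NumberTheory.EllipticCurves.Rank1Residual
  Literature.NumberTheory.EllipticCurves.Rank1Residual.Typed
  Summit.BirchSwinnertonDyer.Rank1Residual
  Summit.BirchSwinnertonDyer.Rank1Residual.Additive
  Summit.BirchSwinnertonDyer.Rank1Residual.X11b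
  Summit.BirchSwinnertonDyer.Rank1Residual.GaloisImage
  Summit.BirchSwinnertonDyer.BirchSwinnertonDyer.Theorems
  Summit.BirchSwinnertonDyer.BirchSwinnertonDyer.Theses.RamifiedHeegnerPair

namespace Summit.BirchSwinnertonDyer.BirchSwinnertonDyer.Theorems.RamifiedPairLowerBound

/-! ## §1 L₀ 26023 on the whole leaf ⟸ five facts ∧ A₀ ∧ U₁ 26022 ∧ rationality -/

/-- **L₀ `Gss2LowerAtThreeRankZero` (item 26023) BY NAME from A₀, U₁ 26022 BY NAME, the rank-zero rationality, and five named facts.**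
`hC0` = A₀: for every non-CM Gss2 rank-ZERO row SOME level `N = N_E`, SOME imaginary quadratic `K` of ODD discriminant with the Heegner
hypothesis for `N` and `r_an(E^{(d_K)}) = 1`, SOME datum `(Dt, H, ι)` with its Heegner point `P ∈ E(K)`, SOME globally minimal model `Wd`
of the twist, SOME depth `M` with `2M ≤ ord₃∏c(E) + ord₃∏c(Wd) + 2·ord₃ c(Dt)`, and SOME McCallum certificate
`X11b.Three.Koly.CertificateAt Dt H.β ι 3 M`. `hU1` = item 26022 verbatim (by name). `hrat` = `L(W,1)/Ω_W ∈ ℚ` on the non-CM rank-`0`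
leaf rows. Then L₀ on every row. Per row: the twist is a leaf curve of analytic rank one (`leaf_twist_of_heegner`, `analyticRank_smul`),
so `hU1` gives its upper half; `E[3]` is irreducible on Gss2 (`irr_of_subGss_of_ne_two`); the door of PART 1 §2 finishes.
[cite: MatarNekovar2019, Thm. 0.7 (p. 456) and §0.11 (p. 457)] [cite: McCallumLMS1991, §5 Cor. 5.6 (p. 310)]
[cite: CastellaGrossiLeeSkinner2022, proof of Thm. 5.3.1, display (5.6)] [cite: Miller2011LMS, Def. 1.1] -/
theorem gss2LowerAtThreeRankZero_of_structIrr_of_certificatesZero_of_leafRankOneUpper_of_ratl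
    (hGZ : ∀ (N : ℕ) [NeZero N] (W : WeierstrassCurve ℚ) (K : Type) [Field K] [NumberField K], gross_zagier N W K)
    (hKo : ∀ (N : ℕ) [NeZero N] (W : WeierstrassCurve ℚ) (K : Type) [Field K] [NumberField K], kolyvagin N W K)
    (hGZK : rank_eq_analyticRank_of_analyticRank_le_one) (hmod : hasEntireLFunction_rat)
    (hMN : MatarNekovar2019.thm07_pow_dvd_card_sha_primary_of_certificate_of_irreducible)
    (hrat : ∀ (W : WeierstrassCurve ℚ) [W.IsElliptic] [W.IsGloballyMinimal], ¬ W.HasCM → Addv W 3 → SubGss W 3 →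
      W.analyticRank = 0 → ∃ q0 : ℚ, W.entireLFunction 1 / (W.realPeriodRat : ℂ) = (q0 : ℂ))
    (hC0 : ∀ (W : WeierstrassCurve ℚ) [W.IsElliptic] [W.IsGloballyMinimal], ¬ W.HasCM →
      Literature.NumberTheory.EllipticCurves.Rank1Residual.Addv W 3 →
      Summit.BirchSwinnertonDyer.Rank1Residual.Additive.SubGss W 3 → W.analyticRank = 0 →
      ∃ (N : ℕ) (_ : NeZero N) (K : Type) (_ : Field K) (_ : NumberField K)
        (Dt : Literature.NumberTheory.EllipticCurves.ModularForms.ModularParametrizationData W N)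
        (H : Literature.NumberTheory.EllipticCurves.HeegnerDatum N (NumberField.discr K)) (ι : K →+* ℂ)
        (P : (W.baseChange K).toAffine.Point) (Wd : WeierstrassCurve ℚ) (_ : Wd.IsElliptic) (_ : Wd.IsGloballyMinimal)
        (Cd : WeierstrassCurve.VariableChange ℚ) (M : ℕ),
        W.conductorNorm ℤ = N ∧ Literature.NumberTheory.EllipticCurves.IsImaginaryQuadratic K ∧ Odd (NumberField.discr K) ∧
        Literature.NumberTheory.EllipticCurves.SatisfiesHeegnerHypothesis N K ∧
        (W.quadraticTwist (NumberField.discr K : ℚ)).analyticRank = 1 ∧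
        WeierstrassCurve.Affine.Point.map ι.toRatAlgHom P =
          Literature.NumberTheory.EllipticCurves.ModularForms.heegnerPointComplex Dt H ∧
        Cd • W.quadraticTwist (NumberField.discr K : ℚ) = Wd ∧
        (2 * M : ℤ) ≤ padicValNat 3 W.tamagawaProduct + padicValNat 3 Wd.tamagawaProduct + 2 * padicValRat 3 (Dt.c : ℚ) ∧
        Summit.BirchSwinnertonDyer.Rank1Residual.X11b.Three.Koly.CertificateAt Dt H.β ι 3 M)
    (hU1 : Summit.BirchSwinnertonDyer.BirchSwinnertonDyer.Theses.RamifiedHeegnerPair.LeafRankOneUpperAtThree) :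
    Summit.BirchSwinnertonDyer.BirchSwinnertonDyer.Theses.RamifiedHeegnerPair.Gss2LowerAtThreeRankZero := by
  intro W _ _ hCM hadd hsub hr
  haveI : Fact (Nat.Prime 3) := ⟨Nat.prime_three⟩
  have hp2 : (3 : ℕ) ≠ 2 := by decide
  obtain ⟨N, hN0, K, _, _, Dt, H, ι, P, Wd, _, _, Cd, M, hN, hK, hodd, hHN, hrt, hP, hWd, hM, hcert⟩ := hC0 W hCM hadd hsub hr
  haveI : NeZero N := hN0
  subst hN
  -- the twist is a leaf curve of analytic rank one, so U₁ gives its upper half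
  obtain ⟨hCMd, haddd, hsubd, -⟩ :=
    Summit.BirchSwinnertonDyer.BirchSwinnertonDyer.Theorems.RamifiedPairUpperBound.leaf_twist_of_heegner W hCM hadd hsub K hK hHN hodd
      Wd Cd hWd
  have hD0 : (NumberField.discr K : ℚ) ≠ 0 := by exact_mod_cast NumberField.discr_ne_zero K
  haveI hEt : (W.quadraticTwist (NumberField.discr K : ℚ)).IsElliptic := W.isElliptic_quadraticTwist hD0
  have hrd : Wd.analyticRank = 1 := by rw [← hWd, analyticRank_smul]; exact hrt
  have hUd : MissingUpperBoundAt Wd 3 := hU1 Wd hCMd haddd hsubd hrd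
  -- `3 ∣ N_W`, `W[3]` irreducible on Gss2
  have h3N : 3 ∣ W.conductorNorm ℤ :=
    (W.dvd_conductorNorm_iff_not_hasGoodReductionAtPrime 3).mpr (not_good_of_addv W 3 hadd)
  have hirr : Irr W 3 := irr_of_subGss_of_ne_two W 3 hp2 hadd hsub
  exact missingLowerBoundAt_three_rankZero_of_structIrrCertificate_of_upperTwist W K Dt H ι P (hGZ _ W K) (hKo _ W K) hGZK hmod
    (heegnerPointOfConductor_one_galoisConj_holds _ W K) (phi_heegnerTau_mem_range_map_singularModuliField_holds _ W K) hMN hCM h3N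
    hirr hr hK hHN hP (hrat W hCM hadd hsub hr) Wd Cd hWd hrd hUd hcert hM

/-! ## §2 The same with the rationality taken from U₀ 26024 (its `#Ш_an(W) ∈ ℚ` clause only) -/

/-- **L₀ 26023 ⟸ five facts ∧ A₀ ∧ U₁ 26022 ∧ U₀ 26024 (rationality only).** The rank-zero rationality input of §1 is a by-product of the
route's own member U₀ (`MissingUpperBoundAt W 3` displays `#Ш_an(W) ∈ ℚ`, whence `L(W,1)/Ω_W ∈ ℚ` in rank `0`); this reading uses NOTHING
ELSE of U₀. So inside `closes` (which binds U₀ and U₁ anyway) L₀ costs exactly A₀ + the five facts — the honest residual content of the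
rank-zero lower member in this route's currency is T1⁻ on the rank-zero frames PLUS the separation S₋ hidden in U₁.
[cite: Miller2011LMS, Def. 1.1] [cite: MatarNekovar2019, Thm. 0.7 (p. 456) and §0.11 (p. 457)] -/
theorem gss2LowerAtThreeRankZero_of_structIrr_of_certificatesZero_of_leafRankOneUpper_of_leafRankZeroUpper
    (hGZ : ∀ (N : ℕ) [NeZero N] (W : WeierstrassCurve ℚ) (K : Type) [Field K] [NumberField K], gross_zagier N W K)
    (hKo : ∀ (N : ℕ) [NeZero N] (W : WeierstrassCurve ℚ) (K : Type) [Field K] [NumberField K], kolyvagin N W K)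
    (hGZK : rank_eq_analyticRank_of_analyticRank_le_one) (hmod : hasEntireLFunction_rat)
    (hMN : MatarNekovar2019.thm07_pow_dvd_card_sha_primary_of_certificate_of_irreducible)
    (hC0 : ∀ (W : WeierstrassCurve ℚ) [W.IsElliptic] [W.IsGloballyMinimal], ¬ W.HasCM →
      Literature.NumberTheory.EllipticCurves.Rank1Residual.Addv W 3 →
      Summit.BirchSwinnertonDyer.Rank1Residual.Additive.SubGss W 3 → W.analyticRank = 0 →
      ∃ (N : ℕ) (_ : NeZero N) (K : Type) (_ : Field K) (_ : NumberField K)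
        (Dt : Literature.NumberTheory.EllipticCurves.ModularForms.ModularParametrizationData W N)
        (H : Literature.NumberTheory.EllipticCurves.HeegnerDatum N (NumberField.discr K)) (ι : K →+* ℂ)
        (P : (W.baseChange K).toAffine.Point) (Wd : WeierstrassCurve ℚ) (_ : Wd.IsElliptic) (_ : Wd.IsGloballyMinimal)
        (Cd : WeierstrassCurve.VariableChange ℚ) (M : ℕ),
        W.conductorNorm ℤ = N ∧ Literature.NumberTheory.EllipticCurves.IsImaginaryQuadratic K ∧ Odd (NumberField.discr K) ∧
        Literature.NumberTheory.EllipticCurves.SatisfiesHeegnerHypothesis N K ∧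
        (W.quadraticTwist (NumberField.discr K : ℚ)).analyticRank = 1 ∧
        WeierstrassCurve.Affine.Point.map ι.toRatAlgHom P =
          Literature.NumberTheory.EllipticCurves.ModularForms.heegnerPointComplex Dt H ∧
        Cd • W.quadraticTwist (NumberField.discr K : ℚ) = Wd ∧
        (2 * M : ℤ) ≤ padicValNat 3 W.tamagawaProduct + padicValNat 3 Wd.tamagawaProduct + 2 * padicValRat 3 (Dt.c : ℚ) ∧
        Summit.BirchSwinnertonDyer.Rank1Residual.X11b.Three.Koly.CertificateAt Dt H.β ι 3 M)
    (hU1 : Summit.BirchSwinnertonDyer.BirchSwinnertonDyer.Theses.RamifiedHeegnerPair.LeafRankOneUpperAtThree)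
    (hU0 : Summit.BirchSwinnertonDyer.BirchSwinnertonDyer.Theses.RamifiedHeegnerPair.LeafRankZeroUpperAtThree) :
    Summit.BirchSwinnertonDyer.BirchSwinnertonDyer.Theses.RamifiedHeegnerPair.Gss2LowerAtThreeRankZero := by
  refine gss2LowerAtThreeRankZero_of_structIrr_of_certificatesZero_of_leafRankOneUpper_of_ratl hGZ hKo hGZK hmod hMN
    (fun W _ _ hCM hadd hsub hr ↦ ?_) hC0 hU1
  -- rationality of `L(W,1)/Ω_W` from `#Ш_an(W) ∈ ℚ` (rank `0`, `Reg = 1`)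
  obtain ⟨q, hq, -⟩ := hU0 W hCM hadd hsub hr
  have hrank : W.mordellWeilRank = 0 := by rw [(hGZK W (by rw [hr]; exact zero_le_one)).1, hr]
  have hΩ : (W.realPeriodRat : ℂ) ≠ 0 := by exact_mod_cast W.realPeriodRat_pos_holds.ne'
  have hc : (W.tamagawaProduct : ℂ) ≠ 0 := by exact_mod_cast W.tamagawaProduct_pos_holds.ne'
  have ht : (W.torsionOrder : ℂ) ≠ 0 := by exact_mod_cast W.torsionOrder_pos_holds.ne'
  refine ⟨q * (W.tamagawaProduct : ℚ) / (W.torsionOrder : ℚ) ^ 2, ?_⟩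
  rw [shaAn_def, W.leadingLCoeff_eq_of_analyticRank_eq_zero hr, W.regulator_eq_one_of_rank_zero hrank] at hq
  push_cast at hq ⊢
  rw [mul_one] at hq
  rw [div_eq_iff hΩ]
  rw [div_eq_iff (mul_ne_zero hΩ hc)] at hq
  field_simp
  linear_combination hq

/-! ## §3 (appended, g6) The rationality input of §1 is FREE: it comes from the parametrisation datum of A₀ itself -/

/-- **`L(W,1)/Ω_W ∈ ℚ` from a parametrisation datum** (Manin–Drinfeld in the tree's currency): `L(W,1) = [0]⁺_f · Ω⁺_f` for the newform
`f = Dt.f` of `W` (`IsNewformOf.entireLFunction_one_eq`) and `ϖ · Ω(W) = Ω⁺_f` with `ϖ ∈ ℚ_{>0}` (Edixhoven §1,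
`ModularParametrizationData.exists_rat_mul_realPeriodRat_eq_plusPeriod`), so `L(W,1)/Ω(W) = [0]⁺_f · ϖ`. Bookkeeping; no analytic-rank hypothesis.
[cite: MazurTateTeitelbaum1986Invent, §I.8 (8.6)] [cite: EdixhovenManin1991, §1] -/
theorem exists_lOne_div_realPeriodRat_eq_of_modularParametrizationData
    (W : WeierstrassCurve ℚ) [W.IsElliptic] [W.IsGloballyMinimal] {N : ℕ} [NeZero N]
    (Dt : ModularParametrizationData W N) :
    ∃ q0 : ℚ, W.entireLFunction 1 / (W.realPeriodRat : ℂ) = (q0 : ℂ) := by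
  obtain ⟨ϖ, -, hϖeq, hΩpos⟩ := Dt.exists_rat_mul_realPeriodRat_eq_plusPeriod
  have hΩ : (W.realPeriodRat : ℂ) ≠ 0 := by exact_mod_cast hΩpos.ne'
  refine ⟨ratPlusSymbol Dt.f 0 * ϖ, ?_⟩
  rw [div_eq_iff hΩ, Dt.isNewformOf.entireLFunction_one_eq, ← hϖeq]
  push_cast
  ring

/-- **L₀ `Gss2LowerAtThreeRankZero` (item 26023) BY NAME ⟸ five named facts ∧ A₀ ∧ U₁ 26022 — NO rationality hypothesis.** As §1, with the
rank-zero rationality `L(W,1)/Ω_W ∈ ℚ` DISCHARGED row by row from the parametrisation datum `Dt` that A₀ supplies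
(`exists_lOne_div_realPeriodRat_eq_of_modularParametrizationData`). Net road for the residual member L₀ in this route's currency:
PUB (GZ ∀, Kolyvagin ∀, GZK, modularity as analytic continuation) ∧ STRUCT (Matar–Nekovář) ∧ A₀ (T1⁻ on the rank-zero frames) ∧ U₁ 26022
(the separation input S₋). CONDITIONAL on U₁ exactly as U₁'s glue 27494 is conditional on L₀ — the two must not both be glued.
[cite: MatarNekovar2019, Thm. 0.7 (p. 456) and §0.11 (p. 457)] [cite: McCallumLMS1991, §5 Cor. 5.6 (p. 310)]
[cite: CastellaGrossiLeeSkinner2022, proof of Thm. 5.3.1, display (5.6)] [cite: EdixhovenManin1991, §1] [cite: Miller2011LMS, Def. 1.1] -/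
theorem gss2LowerAtThreeRankZero_of_structIrr_of_certificatesZero_of_leafRankOneUpper
    (hGZ : ∀ (N : ℕ) [NeZero N] (W : WeierstrassCurve ℚ) (K : Type) [Field K] [NumberField K], gross_zagier N W K)
    (hKo : ∀ (N : ℕ) [NeZero N] (W : WeierstrassCurve ℚ) (K : Type) [Field K] [NumberField K], kolyvagin N W K)
    (hGZK : rank_eq_analyticRank_of_analyticRank_le_one) (hmod : hasEntireLFunction_rat)
    (hMN : MatarNekovar2019.thm07_pow_dvd_card_sha_primary_of_certificate_of_irreducible)
    (hC0 : ∀ (W : WeierstrassCurve ℚ) [W.IsElliptic] [W.IsGloballyMinimal], ¬ W.HasCM →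
      Literature.NumberTheory.EllipticCurves.Rank1Residual.Addv W 3 →
      Summit.BirchSwinnertonDyer.Rank1Residual.Additive.SubGss W 3 → W.analyticRank = 0 →
      ∃ (N : ℕ) (_ : NeZero N) (K : Type) (_ : Field K) (_ : NumberField K)
        (Dt : Literature.NumberTheory.EllipticCurves.ModularForms.ModularParametrizationData W N)
        (H : Literature.NumberTheory.EllipticCurves.HeegnerDatum N (NumberField.discr K)) (ι : K →+* ℂ)
        (P : (W.baseChange K).toAffine.Point) (Wd : WeierstrassCurve ℚ) (_ : Wd.IsElliptic) (_ : Wd.IsGloballyMinimal)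
        (Cd : WeierstrassCurve.VariableChange ℚ) (M : ℕ),
        W.conductorNorm ℤ = N ∧ Literature.NumberTheory.EllipticCurves.IsImaginaryQuadratic K ∧ Odd (NumberField.discr K) ∧
        Literature.NumberTheory.EllipticCurves.SatisfiesHeegnerHypothesis N K ∧
        (W.quadraticTwist (NumberField.discr K : ℚ)).analyticRank = 1 ∧
        WeierstrassCurve.Affine.Point.map ι.toRatAlgHom P =
          Literature.NumberTheory.EllipticCurves.ModularForms.heegnerPointComplex Dt H ∧
        Cd • W.quadraticTwist (NumberField.discr K : ℚ) = Wd ∧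
        (2 * M : ℤ) ≤ padicValNat 3 W.tamagawaProduct + padicValNat 3 Wd.tamagawaProduct + 2 * padicValRat 3 (Dt.c : ℚ) ∧
        Summit.BirchSwinnertonDyer.Rank1Residual.X11b.Three.Koly.CertificateAt Dt H.β ι 3 M)
    (hU1 : Summit.BirchSwinnertonDyer.BirchSwinnertonDyer.Theses.RamifiedHeegnerPair.LeafRankOneUpperAtThree) :
    Summit.BirchSwinnertonDyer.BirchSwinnertonDyer.Theses.RamifiedHeegnerPair.Gss2LowerAtThreeRankZero := by
  intro W _ _ hCM hadd hsub hr
  haveI : Fact (Nat.Prime 3) := ⟨Nat.prime_three⟩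
  have hp2 : (3 : ℕ) ≠ 2 := by decide
  obtain ⟨N, hN0, K, _, _, Dt, H, ι, P, Wd, _, _, Cd, M, hN, hK, hodd, hHN, hrt, hP, hWd, hM, hcert⟩ := hC0 W hCM hadd hsub hr
  haveI : NeZero N := hN0
  subst hN
  -- the twist is a leaf curve of analytic rank one, so U₁ gives its upper half
  obtain ⟨hCMd, haddd, hsubd, -⟩ :=
    Summit.BirchSwinnertonDyer.BirchSwinnertonDyer.Theorems.RamifiedPairUpperBound.leaf_twist_of_heegner W hCM hadd hsub K hK hHN hodd
      Wd Cd hWd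
  have hD0 : (NumberField.discr K : ℚ) ≠ 0 := by exact_mod_cast NumberField.discr_ne_zero K
  haveI hEt : (W.quadraticTwist (NumberField.discr K : ℚ)).IsElliptic := W.isElliptic_quadraticTwist hD0
  have hrd : Wd.analyticRank = 1 := by rw [← hWd, analyticRank_smul]; exact hrt
  have hUd : MissingUpperBoundAt Wd 3 := hU1 Wd hCMd haddd hsubd hrd
  -- `3 ∣ N_W`, `W[3]` irreducible on Gss2; the rationality from the datum
  have h3N : 3 ∣ W.conductorNorm ℤ :=
    (W.dvd_conductorNorm_iff_not_hasGoodReductionAtPrime 3).mpr (not_good_of_addv W 3 hadd)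
  have hirr : Irr W 3 := irr_of_subGss_of_ne_two W 3 hp2 hadd hsub
  exact missingLowerBoundAt_three_rankZero_of_structIrrCertificate_of_upperTwist W K Dt H ι P (hGZ _ W K) (hKo _ W K) hGZK hmod
    (heegnerPointOfConductor_one_galoisConj_holds _ W K) (phi_heegnerTau_mem_range_map_singularModuliField_holds _ W K) hMN hCM h3N
    hirr hr hK hHN hP (exists_lOne_div_realPeriodRat_eq_of_modularParametrizationData W Dt) Wd Cd hWd hrd hUd hcert hM

end Summit.BirchSwinnertonDyer.BirchSwinnertonDyer.Theorems.RamifiedPairLowerBound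

end
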